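import Literature.MathematicalPhysics.QuantumFieldTheory.Balaban1983to89.B11Eq73KernelColumnsCarrier

/-!
# `Balaban1983to89.B11Eq88KernelColumnsComposite` — T. Bałaban, *The variational problem and background fields in renormalization group method for
lattice gauge theories*, Commun. Math. Phys. **102** (1985) 277–309 [Balaban1985Variational], (68)–(73) pp. 288–289, (86)–(88) p. 291 («Applying the
inequalities (3.132) from [5], (55), (73) … we can estimate this functional derivative by O(1)ε₁(Lʲη)⁻³ on Ω_j»), Prop. 4 (97)–(98) pp. 292–293: **THE WEIGHTED
COLUMN LETTER `θ_E′` OF A COMPOSITE `N∘(δ/δA′)(HD)(A′)` ON THE CARRIERS OF (115) THROUGH THE ONE-BLOCK LETTER OF `N∘H` AND THE LETTERS OF `H`, `𝒞′`** —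
the majorant form of print's Neumann series (68)–(73) pushed through a current-valued reader `N` (the cell's `Δπ := currentCLM …(Δ̃_{a,k} − Q_k†aQ_k)`):
the binder `hΘ′` of `B11Eq98W80Composite.quadAnalytic_W80_composite` with `θ_E′ = 2Θ′Gℓ`, a function of the LETTERS ONLY

statement-level skeleton of published theorems with citation tags; proofs where landed; nothing here is a claim about the Yang–Mills mass gap

CITATION HEADER (lean-in-tree rule).  Audit cell `pub-balaban`, sub-cell `t4`, BINDER row NE9; NE9 crux-team LEAF PROVER 01 (`b2b-balaban-t4-ne9-formalise-leaf-01`,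
gen 98; bears_on: R4/N22), step (E′)(3b) of the lineage memo `LOCATED-after-g97.md` §2; sibling of this lineage's `B11Eq73KernelColumnsCarrier` (gen 97), whose
§2 `fderiv_Emap_eq` ((68) on the carriers) and §3 `colSum_kernel_fderiv_Emap_le` (the Neumann majorant) are used BY NAME.  Source read through that file's
verbatim quotations (`paper:balaban1985-cmp102-variational-background` pp. 288–291).  Nothing of print's proof reproduced beyond the majorant bookkeeping;
no constant of print valued.

WHAT IS PROVED (sorry-free; no definition; the letters are displayed HYPOTHESES with named suppliers).
* `norm_equiv_comp_fderiv_Emap_single_le` — the entrywise majorant for the composite: with `K = (HD)′(A′)`, `A = A′ − HD(A′)`, `u(b″, b) = ‖k_K(b″, b)‖`,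
  `‖(N(Kδ_bX))(b′)‖ ≤ ‖A‖·(Σ_y hk′(b′, y)·(g(y, b) + Σ_{b″} g(y, b″)u(b″, b)))·‖X‖` — (68) `Kδ_bX = H𝒞′(A)(1 − K)δ_bX`, the one-block letter `hk′` of `N∘H`,
  the one-bond column letter `g·‖A‖` of `𝒞′(A)`.
* **`colSum_weighted_comp_fderiv_Emap_le`** — THE BINDER `hΘ′`: for any fine weight `r ≥ 0` with `Σ_{b′} r(b′)hk′(b′, y) ≤ Θ′` (every block `y`), on `‖A′‖ < a_C`,
  `Σ_{b′} r(b′)‖(N(Kδ_bX))(b′)‖ ≤ 2Θ′Gℓ·‖A′‖·‖X‖`, `ℓ = (1 − 4bC₂(ε_C + a_C))⁻¹` — the Neumann majorant `Σ_{b″}u(b″, b) ≤ 2‖A‖Θ_HG ≤ 1` of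
  `B11Eq73KernelColumnsCarrier.colSum_kernel_fderiv_Emap_le` under the window `(ε_C + a_C)Θ_HG ≤ ½`.
HONEST SCOPE.  (i) Mechanism on displayed letters; nothing instantiated at the chain's `H̃_{1,k}`, `C_k`, `Δ̃_{a,k}` here (sequel `B11Ineq88ThetaEPrimeLatticeFree`).
(ii) NOT summit progress (cell pub-balaban: NE9 NOT PRINTED ∕ NOT PROVED; «NE9 ⇐ the named binders»; row WALLED ON A MODEL (O-NE9-1; #5 UNRULED); spine PROVED 0∕9;
rung (B)+1 on a finite T⁴ — NOT infinite volume, NOT mass gap, NOT BetaPertH, NOT Clay; HONEST DEPENDENCY: continuum YM on T⁴ ⇐ BetaPertH ∧ nine spine estimates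
(0/9 proved); BetaPertH ⇐ (D1) ∧ (D4) ∧ CAP+tail; G-an2-4 gates asym, D1 and NE2/3/4).  NEW file; imports `B11Eq73KernelColumnsCarrier` ONLY; nothing modified.
Net new unproved facts: 0.
-/

noncomputable section

open scoped BigOperators
open Finset Metric Set Filter Topology

namespace Literature.MathematicalPhysics.QuantumFieldTheory.Balaban1983to89.B11Eq88KernelColumnsComposite

open Literature.MathematicalPhysics.QuantumFieldTheory.Balaban1983to89.B11Prop6Scheme (Prop4Hyp)
open Literature.MathematicalPhysics.QuantumFieldTheory.Balaban1983to89.B11Eq174Chart (solA Regime)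
open Literature.MathematicalPhysics.QuantumFieldTheory.Balaban1983to89.B11Eq90Transpose (kernel kernel_apply single115 sum_single115 flat115_single115)
open Literature.MathematicalPhysics.QuantumFieldTheory.Balaban1983to89.B11Eq90V0primeCurrent (flat115 flat115_apply)
open Literature.MathematicalPhysics.QuantumFieldTheory.Balaban1983to89.B11Eq90V0GroupComposed (T47 T47_apply norm_T47_le norm_T47_lt fderiv_T47
  differentiableOn_solA)
open Literature.MathematicalPhysics.QuantumFieldTheory.Balaban1983to89.B11Eq80Current (Emap Emap_eq_H Emap_eq analyticOnNhd_Emap)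
open Literature.MathematicalPhysics.QuantumFieldTheory.Balaban1983to89.B11Eq73KernelColumnsCarrier (negSup_sum_single negSup_apply_eq_sum_single
  fderiv_Emap_eq colSum_kernel_fderiv_Emap_le)
open B9SectCLatticeCarrier (Bond)
open B11Eq115Space

variable {𝔸 : Type*} [NormedRing 𝔸] [NormedAlgebra ℂ 𝔸] [FiniteDimensional ℂ 𝔸]
variable {d : ℕ} {Pd : Fin d → ℕ} {L η : ℝ} [Fact (0 < L)] [Fact (0 < η)] {lev₀ : Bond d Pd → ℕ} {κ' : Type*} [Fintype κ']
  {lev₁ : κ' → ℕ} {Dc : (Bond d Pd → 𝔸) →ₗ[ℂ] (κ' → 𝔸)}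
variable {β : Type*} [Fintype β] [DecidableEq β] {wB : β → ℝ} [Fact (∀ y, 0 < wB y)]
variable {γ : Type*} [Fintype γ] {w' : γ → ℝ} [Fact (∀ i, 0 < w' i)]

variable {H : NegSup wB 𝔸 →L[ℂ] Space115 L η lev₀ lev₁ Dc} {C : Space115 L η lev₀ lev₁ Dc → NegSup wB 𝔸} {b C₂ c₄ aC εC : ℝ}
  (RC : Regime H 0 C b 0 C₂ c₄ 0 aC εC) (hC : Prop4Hyp C C₂ c₄)
  {hk : Bond d Pd → β → ℝ} (hk0 : ∀ b' y, 0 ≤ hk b' y)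
  (hHk : ∀ (y : β) (Z : 𝔸) (b' : Bond d Pd), ‖flat115 (H ((NegSup.equiv wB 𝔸).symm (Pi.single y Z))) b'‖ ≤ hk b' y * ‖Z‖)
  {ΘH : ℝ} (hH1 : ∀ y, ∑ b', hk b' y ≤ ΘH)
  {gC : β → Bond d Pd → ℝ} (hgC0 : ∀ y bb, 0 ≤ gC y bb)
  (hCg : ∀ A : Space115 L η lev₀ lev₁ Dc, ‖A‖ < εC + aC → ∀ (bb : Bond d Pd) (X : 𝔸) (y : β),
      ‖NegSup.equiv wB 𝔸 (fderiv ℂ C A (single115 (lev₁ := lev₁) (Dc := Dc) bb X)) y‖ ≤ gC y bb * ‖A‖ * ‖X‖)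
  {G : ℝ} (hG : ∀ bb, ∑ y, gC y bb ≤ G) (hq : (εC + aC) * ΘH * G ≤ 1 / 2)
  (N : Space115 L η lev₀ lev₁ Dc →L[ℂ] NegSup w' 𝔸)
  {hk' : γ → β → ℝ} (hk'0 : ∀ b' y, 0 ≤ hk' b' y)
  (hNk : ∀ (y : β) (Z : 𝔸) (b' : γ), ‖NegSup.equiv w' 𝔸 (N (H ((NegSup.equiv wB 𝔸).symm (Pi.single y Z)))) b'‖ ≤ hk' b' y * ‖Z‖)

include RC hC hgC0 hCg hk'0 hNk in
/-- **THE ENTRYWISE MAJORANT FOR THE COMPOSITE `N∘(HD)′(A′)`**: with `K = (HD)′(A′)`, `A = A′ − HD(A′)`, `u(b″, b) = ‖k_K(b″, b)‖`,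
`‖(N(Kδ_bX))(b′)‖ ≤ ‖A‖·(Σ_y hk′(b′, y)·(g(y, b) + Σ_{b″} g(y, b″)u(b″, b)))·‖X‖` — (68) `Kδ_bX = H𝒞′(A)(1 − K)δ_bX`, the one-block letter `hk′` of `N∘H`,
the one-bond column letter of `𝒞′(A)`. [cite: Balaban1985Variational, (68)–(69) p.288, (63) p.287, (88) p.291] -/
theorem norm_equiv_comp_fderiv_Emap_single_le {A' : Space115 L η lev₀ lev₁ Dc} (hA' : ‖A'‖ < aC) (bb : Bond d Pd) (X : 𝔸) (b' : γ) :
    ‖NegSup.equiv w' 𝔸 (N (fderiv ℂ (Emap H C εC) A' (single115 (lev₁ := lev₁) (Dc := Dc) bb X))) b'‖ ≤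
      ‖T47 H C εC A'‖ * (∑ y, hk' b' y * (gC y bb + ∑ b'', gC y b'' * ‖kernel (fderiv ℂ (Emap H C εC) A') b'' bb‖)) * ‖X‖ := by
  set K := fderiv ℂ (Emap H C εC) A' with hK
  set A := T47 H C εC A' with hA
  have hAlt : ‖A‖ < εC + aC := norm_T47_lt RC hA'
  -- `K δ_b X = H (𝒞′(A)(1 − K) δ_b X)`
  have hKX : K (single115 (lev₁ := lev₁) (Dc := Dc) bb X) =
      H (fderiv ℂ C A (single115 (lev₁ := lev₁) (Dc := Dc) bb X - K (single115 (lev₁ := lev₁) (Dc := Dc) bb X))) := by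
    conv_lhs => rw [hK, fderiv_Emap_eq RC hC hA']
    rfl
  set g : NegSup wB 𝔸 := fderiv ℂ C A (single115 (lev₁ := lev₁) (Dc := Dc) bb X - K (single115 (lev₁ := lev₁) (Dc := Dc) bb X)) with hg
  -- the one-block pieces of `g`
  have hgy : ∀ y, ‖NegSup.equiv wB 𝔸 g y‖ ≤ ‖A‖ * (gC y bb + ∑ b'', gC y b'' * ‖kernel K b'' bb‖) * ‖X‖ := by
    intro y
    rw [hg, map_sub, NegSup.equiv_sub, Pi.sub_apply]
    have h1 : ‖NegSup.equiv wB 𝔸 (fderiv ℂ C A (single115 (lev₁ := lev₁) (Dc := Dc) bb X)) y‖ ≤ gC y bb * ‖A‖ * ‖X‖ := hCg A hAlt bb X y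
    have h2 : ‖NegSup.equiv wB 𝔸 (fderiv ℂ C A (K (single115 (lev₁ := lev₁) (Dc := Dc) bb X))) y‖ ≤
        ∑ b'', gC y b'' * ‖A‖ * (‖kernel K b'' bb‖ * ‖X‖) := by
      rw [negSup_apply_eq_sum_single]
      refine (norm_sum_le _ _).trans (Finset.sum_le_sum fun b'' _ => ?_)
      refine (hCg A hAlt b'' _ y).trans (mul_le_mul_of_nonneg_left ?_ (mul_nonneg (hgC0 _ _) (norm_nonneg _)))
      rw [← kernel_apply]
      exact (kernel K b'' bb).le_opNorm X
    calc _ ≤ ‖NegSup.equiv wB 𝔸 (fderiv ℂ C A (single115 (lev₁ := lev₁) (Dc := Dc) bb X)) y‖ +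
          ‖NegSup.equiv wB 𝔸 (fderiv ℂ C A (K (single115 (lev₁ := lev₁) (Dc := Dc) bb X))) y‖ := norm_sub_le _ _
      _ ≤ gC y bb * ‖A‖ * ‖X‖ + ∑ b'', gC y b'' * ‖A‖ * (‖kernel K b'' bb‖ * ‖X‖) := add_le_add h1 h2
      _ = ‖A‖ * (gC y bb + ∑ b'', gC y b'' * ‖kernel K b'' bb‖) * ‖X‖ := by
          rw [mul_add, add_mul, Finset.mul_sum, Finset.sum_mul]
          congr 1
          · ring
          · exact Finset.sum_congr rfl fun _ _ => by ring
  -- `N(Hg) = Σ_y N(H δ_y g(y))` at `b′`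
  have hdec : NegSup.equiv w' 𝔸 (N (H g)) b' = ∑ y, NegSup.equiv w' 𝔸 (N (H ((NegSup.equiv wB 𝔸).symm (Pi.single y (NegSup.equiv wB 𝔸 g y))))) b' := by
    conv_lhs => rw [← negSup_sum_single g]
    rw [map_sum, map_sum, ← NegSup.evalCLM_apply (𝕜 := ℂ), map_sum]
    simp only [NegSup.evalCLM_apply]
  rw [hKX, hdec]
  calc ‖∑ y, NegSup.equiv w' 𝔸 (N (H ((NegSup.equiv wB 𝔸).symm (Pi.single y (NegSup.equiv wB 𝔸 g y))))) b'‖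
      ≤ ∑ y, hk' b' y * ‖NegSup.equiv wB 𝔸 g y‖ := (norm_sum_le _ _).trans (Finset.sum_le_sum fun y _ => hNk y _ b')
    _ ≤ ∑ y, hk' b' y * (‖A‖ * (gC y bb + ∑ b'', gC y b'' * ‖kernel K b'' bb‖) * ‖X‖) :=
        Finset.sum_le_sum fun y _ => mul_le_mul_of_nonneg_left (hgy y) (hk'0 _ _)
    _ = ‖A‖ * (∑ y, hk' b' y * (gC y bb + ∑ b'', gC y b'' * ‖kernel K b'' bb‖)) * ‖X‖ := by
        rw [Finset.mul_sum, Finset.sum_mul]; refine Finset.sum_congr rfl fun y _ => ?_; ring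

include RC hC hk0 hHk hH1 hgC0 hCg hG hq hk'0 hNk in
/-- **THE WEIGHTED COLUMN LETTER `θ_E′` OF THE COMPOSITE `N∘(HD)′(A′)`** — the binder `hΘ′` of `B11Eq98W80Composite.quadAnalytic_W80_composite`: if for a fine
weight `r ≥ 0` the `r`-weighted columns of the one-block letter of `N∘H` are bounded, `Σ_{b′} r(b′)hk′(b′, y) ≤ Θ′` (every block `y`), then on `‖A′‖ < a_C`
`Σ_{b′} r(b′)‖(N((HD)′(A′)δ_bX))(b′)‖ ≤ 2Θ′Gℓ·‖A′‖·‖X‖`, `ℓ = (1 − 4bC₂(ε_C + a_C))⁻¹` — the Neumann majorant `Σ_{b″}u(b″, b) ≤ 2‖A‖Θ_HG ≤ 1`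
((70)–(73)) under the window `(ε_C + a_C)Θ_HG ≤ ½`, and `‖A‖ ≤ ℓ‖A′‖` ((57)). [cite: Balaban1985Variational, (70)–(73) pp.288–289, (86)–(88) p.291, (57) p.286] -/
theorem colSum_weighted_comp_fderiv_Emap_le (hΘH : 0 ≤ ΘH) (bb : Bond d Pd) {r : γ → ℝ} (hr : ∀ b', 0 ≤ r b') {Θ' : ℝ} (hΘ'0 : 0 ≤ Θ')
    (hΘ' : ∀ y, ∑ b', r b' * hk' b' y ≤ Θ') {A' : Space115 L η lev₀ lev₁ Dc} (hA' : ‖A'‖ < aC) (X : 𝔸) :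
    ∑ b', r b' * ‖NegSup.equiv w' 𝔸 (N (fderiv ℂ (Emap H C εC) A' (single115 (lev₁ := lev₁) (Dc := Dc) bb X))) b'‖ ≤
      2 * Θ' * G * (1 / (1 - 4 * b * C₂ * (εC + aC))) * ‖A'‖ * ‖X‖ := by
  set K := fderiv ℂ (Emap H C εC) A' with hK
  set T : β → ℝ := fun y => gC y bb + ∑ b'', gC y b'' * ‖kernel K b'' bb‖ with hT
  have hT0 : ∀ y, 0 ≤ T y := fun y => add_nonneg (hgC0 _ _) (Finset.sum_nonneg fun b'' _ => mul_nonneg (hgC0 _ _) (norm_nonneg _))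
  have hG0 : 0 ≤ G := (Finset.sum_nonneg fun y _ => hgC0 y bb).trans (hG bb)
  have hU0 : 0 ≤ ∑ b'', ‖kernel K b'' bb‖ := Finset.sum_nonneg fun _ _ => norm_nonneg _
  -- `Σ_y T(y) ≤ G·(1 + U)`
  have hTsum : ∑ y, T y ≤ G * (1 + ∑ b'', ‖kernel K b'' bb‖) := by
    simp only [hT, Finset.sum_add_distrib]
    rw [Finset.sum_comm, mul_add, mul_one, Finset.mul_sum]
    refine add_le_add (hG bb) (Finset.sum_le_sum fun b'' _ => ?_)
    rw [← Finset.sum_mul]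
    exact mul_le_mul_of_nonneg_right (hG b'') (norm_nonneg _)
  -- the Neumann majorant: `U ≤ 2‖A‖Θ_HG ≤ 1`
  have hU1 : ∑ b'', ‖kernel K b'' bb‖ ≤ 1 := by
    have h := colSum_kernel_fderiv_Emap_le RC hC hk0 hHk hH1 hgC0 hCg hG hq hΘH hA' bb
    have hq1 : ‖T47 H C εC A'‖ * ΘH * G ≤ 1 / 2 :=
      (mul_le_mul_of_nonneg_right (mul_le_mul_of_nonneg_right (norm_T47_lt RC hA').le hΘH) hG0).trans hq
    rw [← hK] at h
    linarith
  have hA := norm_T47_le RC hA'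
  have h1q : 0 < 1 - 4 * b * C₂ * (εC + aC) := by linarith [RC.contr]
  calc ∑ b', r b' * ‖NegSup.equiv w' 𝔸 (N (K (single115 (lev₁ := lev₁) (Dc := Dc) bb X))) b'‖
      ≤ ∑ b', r b' * (‖T47 H C εC A'‖ * (∑ y, hk' b' y * T y) * ‖X‖) := Finset.sum_le_sum fun b' _ =>
        mul_le_mul_of_nonneg_left (by rw [hK]; exact norm_equiv_comp_fderiv_Emap_single_le RC hC hgC0 hCg N hk'0 hNk hA' bb X b') (hr b')
    _ = ‖T47 H C εC A'‖ * (∑ y, (∑ b', r b' * hk' b' y) * T y) * ‖X‖ := by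
        simp only [Finset.mul_sum, Finset.sum_mul]
        rw [Finset.sum_comm]
        refine Finset.sum_congr rfl fun y _ => Finset.sum_congr rfl fun b' _ => ?_; ring
    _ ≤ ‖T47 H C εC A'‖ * (∑ y, Θ' * T y) * ‖X‖ :=
        mul_le_mul_of_nonneg_right (mul_le_mul_of_nonneg_left
          (Finset.sum_le_sum fun y _ => mul_le_mul_of_nonneg_right (hΘ' y) (hT0 y)) (norm_nonneg _)) (norm_nonneg _)
    _ = ‖T47 H C εC A'‖ * Θ' * (∑ y, T y) * ‖X‖ := by rw [← Finset.mul_sum]; ring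
    _ ≤ ‖T47 H C εC A'‖ * Θ' * (G * (1 + ∑ b'', ‖kernel K b'' bb‖)) * ‖X‖ :=
        mul_le_mul_of_nonneg_right (mul_le_mul_of_nonneg_left hTsum (mul_nonneg (norm_nonneg _) hΘ'0)) (norm_nonneg _)
    _ ≤ (‖A'‖ / (1 - 4 * b * C₂ * (εC + aC))) * Θ' * (G * 2) * ‖X‖ := by
        have h2 : G * (1 + ∑ b'', ‖kernel K b'' bb‖) ≤ G * 2 := mul_le_mul_of_nonneg_left (by linarith) hG0
        have h3 : 0 ≤ G * (1 + ∑ b'', ‖kernel K b'' bb‖) := by positivity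
        gcongr
    _ = 2 * Θ' * G * (1 / (1 - 4 * b * C₂ * (εC + aC))) * ‖A'‖ * ‖X‖ := by ring

end Literature.MathematicalPhysics.QuantumFieldTheory.Balaban1983to89.B11Eq88KernelColumnsComposite

end
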